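/-
Copyright (c) 2026. All rights reserved.
Released under Apache 2.0 license as described in the file LICENSE.
-/
import Summits.Langlands.Langlands.Theorems.SoloInformedBmaxInvariantsInField
import HarnessLib

/-!
# `B_max(F)^{Γ_F} = K₀ = F` unconditionally for absolutely unramified `F` (solo programme, rung Λ6)

Programme `solo-Langlands-informed`, repair of the crystalline clause D2-cris of `Summit.Langlands`
(`SpecC` = the comparison `B_max(F)^{Γ_F} = K₀ = W(k_F)[1/p]`, input (I2) of the repair).

State before this file.  Λ3 (`forall_galBmax_iff_of_isPIntegral`) proves `= K₀` on the `p`-integral part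
`A_max[1/p]` of the constructed `B_max(F) = A_max[1/t]` (`D2Cris.Bmax F p`); Λ4 (`forall_galBmax_iff_mem_range`,
`existsUnique_field_of_forall_galBmax`) identifies every invariant with a unique `c ∈ F` inside `B_dR(F)`; Λ5
(`forall_galBmax_iff_of_tCriterion`) closes the gap `F ∩ B_max(F) = F₀` CONDITIONALLY on Colmez's `t`-divisibility
criterion (TC), an analytic statement about `A_max` not in the tree.

This file closes the same gap with NO analytic input when `F` is absolutely unramified, i.e. when `p` is a
uniformiser of `F` (`hur : Irreducible (p : 𝒪[F])`, `e(F/ℚ_p) = 1`, so `F = F₀ = K₀`):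

* `wittToCompletion_surjective` : for such `F`, Serre's `W(k̄) → 𝒪̂_{F^nr}` is surjective (Frobenius of
  `𝒪̂/p = k̄` is surjective, then Mathlib's `surjective_fontaineTheta`), i.e. `𝒪̂_{F^nr} = W(k̄)`
  (Serre, *Corps locaux* II §5 Th. 3–4);
* `toC_wittToCompletion_injective`, `map_residueGal_eq_of_wittToCompletion_eq` : `W(k̄) → ℂ_F` is injective, so a
  Witt vector mapping to an element of `𝒪_F` is `Γ_F`-invariant;
* `embBdRHom_coe_eq_bmaxPlusToBdR` (key lemma, any `F`) : if `z ∈ W(k̄)` maps to `a ∈ 𝒪_F ⊆ 𝒪̂_{F^nr}`, then the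
  two images of `a` in `B_dR⁺(F)` — Fontaine's `F ↪ B_dR⁺` (`embBdRHom`) and `W(k̄) → 𝔸_inf → A_max → B_dR⁺` —
  AGREE (the second is `Γ_F`-invariant, hence `embBdRHom c` for some `c ∈ F` by `B_dR^{Γ_F} = F`, and `θ` gives `c = a`);
* `exists_mul_pow_eq_wittToAinf_of_forall_galBmax` : hence for unramified `F` every `Γ_F`-invariant
  `y ∈ B_max(F)` is `p⁻ⁿ ι(z)` with `z ∈ W(k̄)` (write the `c ∈ F` of Λ4 as `p⁻ⁿ a`, `a ∈ 𝒪_F = image of W(k̄)`);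
* `forall_galBmax_iff_of_unramified` ★ : **`B_max(F)^{Γ_F} = K₀` for absolutely unramified `F`**, the statement of
  Λ5 with the hypothesis (TC) REMOVED — input (I2) of the D2-cris repair is a theorem when `e(F/ℚ_p) = 1`.

What remains of (I2) after this file: the ramified case `e > 1`, where `F ∩ B_max(F) = F₀ ⊊ F` genuinely needs
(TC) (Λ5) or the injectivity of `F ⊗_{F₀} B_max⁺ → B_dR⁺` (Fontaine, Exp. III §4.1; Colmez §III.3).

References: Serre, *Local Fields* (1979), Ch. II §5 Th. 3–4; Fontaine, Astérisque 223 (1994), Exp. II §1.5,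
Exp. III §4.1; Colmez, Ann. of Math. 148 (1998), §III.2–III.3.
-/

noncomputable section

open WittVector Field IsLocalRing ValuativeRel
open Literature.NumberTheory.GaloisRepresentations Literature.NumberTheory.PAdicHodge
open Literature.NumberTheory.GaloisRepresentations.IsNonarchimedeanLocalField

namespace Summit.Langlands.Langlands.Theorems

namespace SpecC

variable {F : Type} [Field F] [ValuativeRel F] [TopologicalSpace F] [IsNonarchimedeanLocalField F] [CharZero F]
  {p : ℕ} [Fact p.Prime] [Fact (¬ IsUnit (p : integerC F))] [IsAdicComplete (Ideal.span {(p : integerC F)}) (integerC F)]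

/-! ### §1 `p` a uniformiser of `F`: scaling into `𝒪_F` -/

omit [CharZero F] [Fact p.Prime] [Fact (¬ IsUnit (p : integerC F))]
  [IsAdicComplete (Ideal.span {(p : integerC F)}) (integerC F)] in
/-- If `p` is a uniformiser of `F`, every `c ∈ F` becomes integral after multiplication by a power of `p`:
`c · pⁿ ∈ 𝒪_F`. (`c = a/b`, `b ~ pⁿ` in the discrete valuation ring `𝒪_F`.) [folklore]
[cite: SerreLocalFields1979, Ch. II §5] -/
theorem exists_coe_eq_mul_natCast_pow (hur : Irreducible (p : 𝒪[F])) (c : F) :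
    ∃ (n : ℕ) (a : 𝒪[F]), algebraMap 𝒪[F] F a = c * (p : F) ^ n := by
  obtain ⟨⟨a, b⟩, h⟩ := IsLocalization.surj (nonZeroDivisors 𝒪[F]) c
  obtain ⟨n, u, hu⟩ := IsDiscreteValuationRing.associated_pow_irreducible (nonZeroDivisors.ne_zero b.2) hur
  refine ⟨n, a * u, ?_⟩
  rw [← map_natCast (algebraMap 𝒪[F] F) p, ← map_pow, ← hu, map_mul, map_mul, ← h, mul_assoc]

/-! ### §2 `W(k̄) = 𝒪̂_{F^nr}` for absolutely unramified `F`, and `W(k̄) ↪ ℂ_F` -/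

section Witt

variable [Fact (¬ IsUnit (p : maxUnramifiedCompletion F))] [CharP (ResidueField (maxUnramifiedCompletion F)) p]
  [IsAdicComplete (Ideal.span {(p : maxUnramifiedCompletion F)}) (maxUnramifiedCompletion F)]

omit [Fact (¬ IsUnit (p : integerC F))] [IsAdicComplete (Ideal.span {(p : integerC F)}) (integerC F)]
  [CharP (ResidueField (maxUnramifiedCompletion F)) p]
  [IsAdicComplete (Ideal.span {(p : maxUnramifiedCompletion F)}) (maxUnramifiedCompletion F)] [CharZero F] in
/-- If `p` is a uniformiser of `F` then `𝒪̂_{F^nr}/p = k̄` and **Frobenius is surjective on `𝒪̂_{F^nr}/p`**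
(`k̄` is algebraically closed). [cite: SerreLocalFields1979, Ch. II §5] -/
theorem frobenius_modP_completion_surjective (hur : Irreducible (p : 𝒪[F])) :
    Function.Surjective (frobenius (ModP (maxUnramifiedCompletion F) p) p) := by
  have hmax : maximalIdeal (maxUnramifiedCompletion F) = Ideal.span {(p : maxUnramifiedCompletion F)} := by
    rw [maxUnramifiedCompletion.maximalIdeal_eq_span_uniformizer hur, map_natCast]
  intro y
  obtain ⟨a, rfl⟩ := Ideal.Quotient.mk_surjective y
  obtain ⟨r₀, hr₀⟩ := IsAlgClosed.exists_pow_nat_eq (residue (maxUnramifiedCompletion F) a) (Fact.out : p.Prime).pos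
  obtain ⟨r, rfl⟩ := residue_surjective r₀
  refine ⟨Ideal.Quotient.mk _ r, ?_⟩
  rw [frobenius_def, ← map_pow, Ideal.Quotient.eq, ← hmax, ← IsLocalRing.residue_eq_zero_iff, map_sub, map_pow, hr₀,
    sub_self]

omit [Fact (¬ IsUnit (p : integerC F))] [IsAdicComplete (Ideal.span {(p : integerC F)}) (integerC F)] in
/-- **`𝒪̂_{F^nr} = W(k̄)` for absolutely unramified `F`**: if `p` is a uniformiser of `F`, Serre's embedding
`W(k̄) → 𝒪̂_{F^nr}` (`wittToCompletion`) is surjective. (Fontaine's `θ` of `𝒪̂_{F^nr}` is surjective by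
`frobenius_modP_completion_surjective` and Mathlib's `surjective_fontaineTheta`.)
[cite: SerreLocalFields1979, Ch. II §5 Th. 3–4] -/
theorem wittToCompletion_surjective (hur : Irreducible (p : 𝒪[F])) : Function.Surjective (wittToCompletion F p) := by
  intro y
  obtain ⟨w, hw⟩ := surjective_fontaineTheta (frobenius_modP_completion_surjective (F := F) hur) y
  obtain ⟨x, hx⟩ := WittVector.map_surjective (residueTiltEquiv F p).toRingHom (residueTiltEquiv F p).surjective w
  exact ⟨x, by rw [wittToCompletion_apply, hx, hw]⟩

omit [Fact (¬ IsUnit (p : integerC F))] [IsAdicComplete (Ideal.span {(p : integerC F)}) (integerC F)] in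
/-- **`W(k̄) → ℂ_F` is injective** (`z ≠ 0` is `pᵐ u` with `u` a unit of `W(k̄)`, `k̄` being a perfect field, and
`p ≠ 0` in `ℂ_F`). [cite: SerreLocalFields1979, Ch. II §5–§6] -/
theorem toC_wittToCompletion_injective :
    Function.Injective fun z : WittVector p (ResidueField (maxUnramifiedCompletion F)) =>
      maxUnramifiedCompletion.toC F (wittToCompletion F p z) := by
  haveI : PerfectRing (ResidueField (maxUnramifiedCompletion F)) p := perfectRing_residueField_completion
  let g : WittVector p (ResidueField (maxUnramifiedCompletion F)) →+* CompletedAlgClosure F :=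
    (maxUnramifiedCompletion.toC F).comp (wittToCompletion F p)
  change Function.Injective g
  refine (injective_iff_map_eq_zero g).2 fun z hz => by_contra fun hz0 => ?_
  obtain ⟨m, u, rfl⟩ := WittVector.exists_eq_pow_p_mul' z hz0
  rw [map_mul, map_pow, map_natCast] at hz
  exact mul_ne_zero (pow_ne_zero _ (natCast_C_ne_zero (F := F) (Fact.out : p.Prime).ne_zero))
    ((u.isUnit.map g).ne_zero) hz

set_option maxHeartbeats 1600000 in
/-- **A Witt vector mapping into `𝒪_F` is `Γ_F`-invariant**: if `wittToCompletion z = a ∈ 𝒪_F ⊆ 𝒪̂_{F^nr}` then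
`𝕎(σ̄) z = z` for every `σ ∈ Γ_F` (compare the images in `ℂ_F`: `θ` and `W(k̄) → 𝔸_inf(F)` are `Γ_F`-equivariant,
`Γ_F` fixes `F ⊆ ℂ_F`, and `W(k̄) → ℂ_F` is injective). [cite: FontaineAsterisque223III, Exp. II §1.2] -/
theorem map_residueGal_eq_of_wittToCompletion_eq (σ : absoluteGaloisGroup F)
    {z : WittVector p (ResidueField (maxUnramifiedCompletion F))} {a : 𝒪[F]}
    (hz : wittToCompletion F p z = algebraMap 𝒪[F] (maxUnramifiedCompletion F) a) :
    WittVector.map (residueGal σ) z = z := by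
  have h : maxUnramifiedCompletion.toC F (wittToCompletion F p (WittVector.map (residueGal σ) z)) =
      maxUnramifiedCompletion.toC F (wittToCompletion F p z) :=
    calc maxUnramifiedCompletion.toC F (wittToCompletion F p (WittVector.map (residueGal σ) z))
        = ((fontaineTheta (integerC F) p (wittToAinf F p (WittVector.map (residueGal σ) z)) : integerC F) :
            CompletedAlgClosure F) := (coe_fontaineTheta_wittToAinf _).symm
      _ = ((fontaineTheta (integerC F) p (galAinf σ (wittToAinf F p z)) : integerC F) : CompletedAlgClosure F) := by
          rw [galAinf_wittToAinf]
      _ = σ • ((fontaineTheta (integerC F) p (wittToAinf F p z) : integerC F) : CompletedAlgClosure F) := by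
          rw [fontaineTheta_galAinf, coe_galInt]
      _ = σ • maxUnramifiedCompletion.toC F (wittToCompletion F p z) := by rw [coe_fontaineTheta_wittToAinf]
      _ = maxUnramifiedCompletion.toC F (wittToCompletion F p z) := by
          rw [hz, toC_algebraMap, CompletedAlgClosure.smul_algebraMap]
  exact toC_wittToCompletion_injective h

set_option maxHeartbeats 1600000 in
/-- **Key lemma — the two images of `𝒪_F` in `B_dR⁺(F)` agree** (any `F`): if `z ∈ W(k̄)` maps to
`a ∈ 𝒪_F ⊆ 𝒪̂_{F^nr}`, then Fontaine's embedding `F ↪ B_dR⁺(F)` sends `a` to the image of `z` under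
`W(k̄) → 𝔸_inf(F) → A_max → B_dR⁺(F)`.  (The latter image is `Γ_F`-invariant by
`map_residueGal_eq_of_wittToCompletion_eq`, hence equals `embBdRHom c` for a `c ∈ F` by `B_dR(F)^{Γ_F} = F`
(`fixedPoints_fracBdR_eq_range`); applying `θ` gives `c = a` in `ℂ_F`.) [cite: FontaineAsterisque223III, Exp. II §1.5, Exp. III §4.1] -/
theorem embBdRHom_coe_eq_bmaxPlusToBdR (hp : valuation F p < 1) (hF : Function.Surjective (fontaineTheta (integerC F) p))
    {z : WittVector p (ResidueField (maxUnramifiedCompletion F))} {a : 𝒪[F]}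
    (hz : wittToCompletion F p z = algebraMap 𝒪[F] (maxUnramifiedCompletion F) a) :
    embBdRHom hp hF (a : F) = bmaxPlusToBdR F p (ainfToBmaxPlus F p (wittToAinf F p z)) := by
  haveI := isDomain_bDeRhamPlus (F := F) (p := p) hF
  -- `x = ι(z) ∈ A_max` is `Γ_F`-invariant
  have hx : ∀ σ : absoluteGaloisGroup F, galBmaxPlus σ (ainfToBmaxPlus F p (wittToAinf F p z)) =
      ainfToBmaxPlus F p (wittToAinf F p z) := fun σ => by
    rw [galBmaxPlus_ainfToBmaxPlus_wittToAinf, map_residueGal_eq_of_wittToCompletion_eq σ hz]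
  -- hence its image in `B_dR(F)` is in `F`
  have hX : algebraMap (BDeRhamPlus (integerC F) p) (FracBdR F p)
      (bmaxPlusToBdR F p (ainfToBmaxPlus F p (wittToAinf F p z))) ∈
      {y : FracBdR F p | ∀ σ : absoluteGaloisGroup F, σ • y = y} := by
    intro σ
    rw [smul_algebraMap_fracBdR, galBdRPlus_bmaxPlusToBdR, hx σ]
  rw [fixedPoints_fracBdR_eq_range hp hF] at hX
  obtain ⟨c, hc⟩ := hX
  have hc' : embBdRHom hp hF c = bmaxPlusToBdR F p (ainfToBmaxPlus F p (wittToAinf F p z)) :=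
    algebraMap_fracBdR_injective hc
  -- `θ`: `c = a` in `ℂ_F`
  have hθ : algebraMap F (CompletedAlgClosure F) c = algebraMap F (CompletedAlgClosure F) (a : F) := by
    rw [← thetaBdR_embBdRHom hp hF c, hc', thetaBdR_bmaxPlusToBdR, thetaBmaxPlus_ainfToBmaxPlus,
      coe_fontaineTheta_wittToAinf, hz, toC_algebraMap]
  have hca : c = (a : F) := (algebraMap F (CompletedAlgClosure F)).injective hθ
  subst hca
  exact hc'

end Witt

/-! ### §3 `B_max(F)^{Γ_F} = K₀` for absolutely unramified `F` -/

section Main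

variable [CharP (ResidueField (integerC F)) p]
  [Fact (¬ IsUnit (p : maxUnramifiedCompletion F))] [CharP (ResidueField (maxUnramifiedCompletion F)) p]
  (hp : valuation F p < 1) (hF : Function.Surjective (fontaineTheta (integerC F) p))

omit [CharP (ResidueField (integerC F)) p] in
include hp hF in
set_option maxHeartbeats 1600000 in
/-- **Invariants of `B_max(F)` are `p⁻ⁿ ι(z)` when `F` is absolutely unramified**: if `p` is a uniformiser of `F`,
every `Γ_F`-invariant `y ∈ B_max(F) = A_max[1/t]` satisfies `y · pⁿ = ι(z)` for some `n` and some `z ∈ W(k̄)`.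
(By Λ4, `y` is `c ∈ F` inside `B_dR(F)`; `c · pⁿ = a ∈ 𝒪_F` (`exists_coe_eq_mul_natCast_pow`); `a` is hit by
`W(k̄)` (`wittToCompletion_surjective`); the two images of `a` in `B_dR⁺` agree (`embBdRHom_coe_eq_bmaxPlusToBdR`);
and `B_max(F) → B_dR(F)` is injective.) [cite: Colmez1998Annals, §III.2–III.3] [cite: FontaineAsterisque223III, Exp. III §4.1] -/
theorem exists_mul_pow_eq_wittToAinf_of_forall_galBmax (hur : Irreducible (p : 𝒪[F])) {y : D2Cris.Bmax F p}
    (hy : ∀ σ : absoluteGaloisGroup F, D2Cris.galBmax σ y = y) :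
    ∃ (n : ℕ) (z : WittVector p (ResidueField (maxUnramifiedCompletion F))),
      y * (p : D2Cris.Bmax F p) ^ n =
        algebraMap (BmaxPlus F p) (D2Cris.Bmax F p) (ainfToBmaxPlus F p (wittToAinf F p z)) := by
  haveI := isAdicComplete_span_natCast_completion (F := F) hp (Fact.out : p.Prime).ne_zero
  haveI := isDomain_bDeRhamPlus (F := F) (p := p) hF
  obtain ⟨c, hc, -⟩ := existsUnique_field_of_forall_galBmax hp hF hy
  obtain ⟨n, a, ha⟩ := exists_coe_eq_mul_natCast_pow hur c
  obtain ⟨z, hz⟩ := wittToCompletion_surjective hur (algebraMap 𝒪[F] (maxUnramifiedCompletion F) a)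
  have ha' : (a : F) = c * (p : F) ^ n := ha
  refine ⟨n, z, bmaxToFracBdR_injective hF ?_⟩
  rw [bmaxToFracBdR_algebraMap, ← embBdRHom_coe_eq_bmaxPlusToBdR hp hF hz, ha', map_mul, map_pow, map_natCast, ← hc,
    map_mul, map_pow, map_natCast, map_mul, map_pow, map_natCast]

include hp hF in
/-- ★ **`B_max(F)^{Γ_F} = K₀` for absolutely unramified `F`, unconditionally**: if `p` is a uniformiser of `F`
(`e(F/ℚ_p) = 1`), an element `y` of the constructed `B_max(F) = A_max[1/t]` (`D2Cris.Bmax F p`) is `Γ_F`-invariant iff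
`y · pⁿ = ι z` for some `n` and some `Γ_F`-invariant unramified Witt vector `z ∈ W(k̄)^{Γ_F} = W(k_F)`, i.e. iff
`y ∈ K₀ = W(k_F)[1/p]` — the statement of Λ5 `forall_galBmax_iff_of_tCriterion` with the hypothesis (TC) removed.
(Forward: `exists_mul_pow_eq_wittToAinf_of_forall_galBmax`, then Λ3 `forall_galBmax_iff_of_isPIntegral`; backward: Λ3.)
[cite: Colmez1998Annals, §III.2–III.3] [cite: FontaineAsterisque223III, Exp. III §4.1] [cite: SerreLocalFields1979, Ch. II §5] -/
theorem forall_galBmax_iff_of_unramified (hur : Irreducible (p : 𝒪[F])) (y : D2Cris.Bmax F p) :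
    (∀ σ : absoluteGaloisGroup F, D2Cris.galBmax σ y = y) ↔
      ∃ (n : ℕ) (z : WittVector p (ResidueField (maxUnramifiedCompletion F))),
        (∀ σ : absoluteGaloisGroup F, WittVector.map (residueGal σ) z = z) ∧
          y * (p : D2Cris.Bmax F p) ^ n =
            algebraMap (BmaxPlus F p) (D2Cris.Bmax F p) (ainfToBmaxPlus F p (wittToAinf F p z)) := by
  constructor
  · intro hy
    obtain ⟨n, z, hx⟩ := exists_mul_pow_eq_wittToAinf_of_forall_galBmax hp hF hur hy
    exact (forall_galBmax_iff_of_isPIntegral hp ⟨n, _, hx⟩).1 hy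
  · rintro ⟨n, z, hz, hx⟩
    exact (forall_galBmax_iff_of_isPIntegral hp ⟨n, _, hx⟩).2 ⟨n, z, hz, hx⟩

include hp hF in
/-- The invariants with the witness normalised: for absolutely unramified `F`, a `Γ_F`-invariant `y ∈ A_max[1/t]` is
`y = p⁻ⁿ ι(z)` with `z ∈ W(k̄)^{Γ_F} = W(k_F)`. [cite: Colmez1998Annals, §III.2–III.3] -/
theorem exists_eq_wittToAinf_of_forall_galBmax_of_unramified (hur : Irreducible (p : 𝒪[F])) {y : D2Cris.Bmax F p}
    (hy : ∀ σ : absoluteGaloisGroup F, D2Cris.galBmax σ y = y) :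
    ∃ (n : ℕ) (z : WittVector p (ResidueField (maxUnramifiedCompletion F))),
      (∀ σ : absoluteGaloisGroup F, WittVector.map (residueGal σ) z = z) ∧
        y * (p : D2Cris.Bmax F p) ^ n =
          algebraMap (BmaxPlus F p) (D2Cris.Bmax F p) (ainfToBmaxPlus F p (wittToAinf F p z)) :=
  (forall_galBmax_iff_of_unramified hp hF hur y).1 hy

omit [CharP (ResidueField (integerC F)) p] in
include hp hF in
/-- **Input (I2) for unramified `F` in the shape consumed by Λ5**: if `p` is a uniformiser of `F`, every `Γ_F`-invariant of
`B_max(F)` is `p`-integral up to a power of `p` (the hypothesis `hint` of Λ3), with no `t`-divisibility criterion.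
[cite: Colmez1998Annals, §III.2–III.3] -/
theorem exists_mul_pow_eq_algebraMap_of_forall_galBmax_of_unramified (hur : Irreducible (p : 𝒪[F])) {y : D2Cris.Bmax F p}
    (hy : ∀ σ : absoluteGaloisGroup F, D2Cris.galBmax σ y = y) :
    ∃ (n : ℕ) (x : BmaxPlus F p), y * (p : D2Cris.Bmax F p) ^ n = algebraMap (BmaxPlus F p) (D2Cris.Bmax F p) x := by
  obtain ⟨n, z, hx⟩ := exists_mul_pow_eq_wittToAinf_of_forall_galBmax hp hF hur hy
  exact ⟨n, _, hx⟩

end Main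

end SpecC

end Summit.Langlands.Langlands.Theorems

end
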